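import Literature.MathematicalPhysics.QuantumFieldTheory.Balaban1983to89.B6SectADomainsV1
import Literature.MathematicalPhysics.QuantumFieldTheory.Balaban1983to89.B5RowSumsP12Lattice
import Literature.MathematicalPhysics.QuantumFieldTheory.Balaban1983to89.B5Eq117TorusCarriers
import Summits.QuantumFields.YangMills.Theorems.UnitScaleTiltProp8FlatMinimizerH
import HarnessLib

/-!
# Route `UnitScaleTilt`, crux K1 child «MinimiserStabilityRegPr» (stmt-QuantumFields-19200), leaf V2′ `stub_halvingStep` — PILLAR F3′
# (k-LEVEL FLAT OPERATORS, located finding F-p1g15-1 / UV3-NODE §24), FILE 1: **THE CUBE SEQUENCE (144) OF [Balaban1985Variational]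
# SECT. F AT THE SETUP TORUS AS A NESTED DOMAIN FAMILY OF [Balaban1984PropagatorsII] (2.1)–(2.4)** — the object on which print's `H` (157)
# and `G̃` (158) are the MULTI-LEVEL operators `GQ*(QGQ*)⁻¹` (2.35) / `G − HQG` of the tree's `B6SectADomainsV1.Domains` /
# `B6SectAVectorModelV1` / `B6SectACriticalPointV1` (lit-balaban p21/r03), with its frozen level-0 exterior `Λ₀ = T ∖ □₁`

Cell `ym3-torus` (HUMAN RULING D-0037, YM ladder rung R3), seat `ym3-torus-p1` gen 15.  `--supports stmt-QuantumFields-19200 --as helper`;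
count-neutral.  Definitions (`rad`, `cubeFin`, `cubeSeq`, `cubeSet`) + their geometry; no analysis.

THE PRINT ([Balaban1985Variational] = CMP **102** (1985) 277–309, p. 300 [PDF 24]): *«Let us take a cube □ intersecting Ω_j but not Ω_{j+1}, of a
size 2MLʲη … we construct the sequence of cubes {□_n}, and the cube □̃. Let us recall that □₀ ⊃ □₁ ⊃ … ⊃ □_k ⊃ □,
dist(□_{n+1}, □_nᶜ) = R₁M₁Lⁿη, n = 0, 1, …, k, (144) and □̃ is a cube with dist(□, □̃ᶜ) = 2R₁M₁L^kη»*; p. 301 (150): U′_k minimises in the space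
with the MULTI-LEVEL constraints on `Ω_j = □_j`; p. 302 (156)–(157): *«Q_j(ηA) = B on Λ′_j, j = 0, 1, …, k … LʲηQ_jA′ = B on Λ′_j»*.
[Balaban1984PropagatorsII] p. 224 (2.1)–(2.4): *«Ω_j = Bʲ(Ω_j^{(j)}) … Λ_j = Ω_j^{(j)} ∖ Ω_{j+1}^{(j)} … Λ₀ = Ω₁ᶜ»*, (2.6) *«A = B₀ on Λ₀, Q_jA = B_j on Λ_j»*.

TYPED READING (every choice displayed).  `P : Params`; fine torus `Site P 0`, level-`j` torus `Site P j` (`j`-blocks, `iterBlockOf j`); the top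
level `k` (print's `k`; at the d = 3 carrier `k = K − n`, `L^kη = 1`).  Centre: a FINE site `x₀`; `c_j := iterBlockOf j x₀` its `j`-block.  Distances:
the sup circular distance `distSite (Mk P j)` of pub-balaban's `B5Prop12FieldsLattice` (used by p1 g14's `FlatMinimizerHDecay`/`FlatPropagatorWeighted`).
* `rad L ρ S i` — the radius of `□_{k−i}` IN LEVEL-`(k−i)` UNITS: `rad 0 = ρ` (the innermost cube `□_k`, radius `ρ` unit cubes; print: `□_k ⊃ □`, `□` of
  radius `M`), `rad (i+1) = L·rad i + (L − 1) + S` (one level finer: the same cube has radius `≤ L·rad i + (L−1)` in the finer units, plus the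
  SEPARATION `S` of (144) — print `S = R₁M₁`: «dist(□_{n+1}, □_nᶜ) = R₁M₁Lⁿη» in level-`n` units is `R₁M₁`).  `rad i + (S+1) ≤ L^i(ρ + S + 1)`
  (`rad_add_le`): ALL cubes lie within `ρ + S + 1` unit lengths of `x₀` — the annuli shrink geometrically outward, `□₀ ⊂ □̃` uniformly in `k`.
* `cubeFin x₀ k ρ S j ⊂ Site P j` — `□_j^{(j)}`: the `j`-blocks within `distSite ≤ rad (k − j)` of `c_j` (meaningful for `j ≤ k`).
* **`cubeSeq x₀ k hk ρ S : B6SectADomainsV1.Domains P`** — (144) AS A NESTED FAMILY OF [B6] (2.1)–(2.4): `Om 0 = T` (the structure's convention: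
  `Λ₀ = T ∖ □₁` is the FROZEN level-0 region — print freezes `A′` on `□₀ ∖ □₁` and has no field outside `□₀`; for the linear problem (157)
  the extra frozen exterior is inert), `Om j = □_j^{(j)}` for `1 ≤ j ≤ k`, `Om j = ∅` for `j > k`; NESTING `B^{j+1}(□_{j+1}) ⊆ B^j(□_j)` PROVED from
  the cross-level distance inequality `dist_j(y, c_j) ≤ L·dist_{j+1}(B(y), c_{j+1}) + (L − 1)` (`distSite_le_blockOf`).
* `cubeSet x₀ k ρ S : ℕ → Set (Site P 0)` — the SAME cubes as sets of FINE sites (`□_j = Bʲ(□_j^{(j)})`, INCLUDING `□₀` = the fine cube of radius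
  `rad k`), the domain-sequence letter `Ω : ℕ → Set (Site P 0)` of the F1/F2 files (`B8Thm2SetupTorus.pullDom`, p1 g14 `Prop7LocalChart.inSpace_mul_of_local_chart`);
  `inOm_cubeSeq_iff` identifies the two readings for `1 ≤ j ≤ k`.

WHAT IS PROVED (sorry-free; axioms standard).  §1 `rad` arithmetic (`rad_succ`, `rad_add_le`, monotonicity in `i`).  §2 THE CROSS-LEVEL DISTANCE
INEQUALITIES on the Setup tori (`sitesPerDir j = L·sitesPerDir (j+1)`): `natAbs_valMinAbs_sub_le_blockOf` (coordinatewise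
`|y_μ − c_μ|_∘ ≤ L·|B(y)_μ − B(c)_μ|_∘ + (L−1)`), `distSite_le_blockOf`, `distSite_iterBlockOf_le` (iterated).  §3 the cubes: `mem_cubeFin_iff`,
`blockOf_mem_cubeFin` (nesting one level), `cubeSeq` with its fields, `cubeSeq_Om_pos`, `inOm_cubeSeq_iff`, `cubeSet_succ_subset` (`□_{j+1} ⊆ □_j` as
fine sets), `center_mem_cubeSet`, **`sep144`** — (144): a fine site of `□_{n+1}` and a fine site outside `□_n` have `n`-blocks at `distSite ≥ S + 1`
(level-`n` units).  §4 the d = 3 carrier form `cubeSeqT3 F n K x₀ ρ S : Domains (F.P K)` (`k = K − n`, p1 g14's `FlatMinimizerH.le_T3`).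

HONEST SCOPE.  Geometry only.  The ESTIMATES for the k-level `H`, `G̃` of this family ([Balaban1984PropagatorsII] Prop. 2.2 (2.47)–(2.51), Prop. 2.7,
Cor. 2.8 — cited by print at (162)) are NOT here and NOT in the tree for families with `Λ₀ ≠ ∅` (gap G-F3′-L0, UV3-NODE §24.3); lit-balaban's
hypothesis-free k-level layer (`B6Cor28EntriesKLevelV1`, …) covers `Ω₁ = T` only.  `□̃`, the axial gauge and (145)–(151) are F1's business.  The
«sum of big blocks» clause of (1.4)/(2.2) (cubes as unions of `M₁`-blocks) is not imposed here (radii are free parameters; choose `ρ`, `S` multiples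
as needed).  NOT a claim about the mass gap.

References: [Balaban1985Variational] (144) p.300, (150) p.301, (156)–(157) p.302; [Balaban1984PropagatorsII] (2.1)–(2.6) p.224.
-/

set_option autoImplicit false

noncomputable section

namespace Summit.QuantumFields.YangMills.Theorems.FlatCubeSequence

open Literature.MathematicalPhysics.QuantumFieldTheory.Balaban1983to89
open B5Eq117TorusCarriers (Mk)
open B5Eq118OneStroke (iterBlockOf iterBlockOf_succ iterBlockOf_zero)
open B5Prop12FieldsLattice (distSite distSite_self distSite_nonneg)
open B5RowSumsP12Lattice (distSite_comm distSite_triangle)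
open B6SectADomainsV1 (Domains)

variable {P : Params} {j : ℕ}

/-! ## §1 The radii of (144) -/

/-- **The radii of the cube sequence (144)** in the units of their own level, counted from the innermost cube outward: `rad 0 = ρ`
(`□_k`), `rad (i+1) = L·rad i + (L − 1) + S` (`□_{k−i−1}` exceeds the refinement of `□_{k−i}` by the separation `S`; print `S = R₁M₁`:
«dist(□_{n+1}, □_nᶜ) = R₁M₁Lⁿη»). [cite: Balaban1985Variational, (144) p.300] -/
def rad (L ρ S : ℕ) : ℕ → ℕ
  | 0 => ρ
  | i + 1 => L * rad L ρ S i + (L - 1) + S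

/-- unfolding. [cite: Balaban1985Variational, (144) p.300] -/
@[simp] theorem rad_zero (L ρ S : ℕ) : rad L ρ S 0 = ρ := rfl

/-- unfolding. [cite: Balaban1985Variational, (144) p.300] -/
theorem rad_succ (L ρ S i : ℕ) : rad L ρ S (i + 1) = L * rad L ρ S i + (L - 1) + S := rfl

/-- **ALL CUBES WITHIN `ρ + S + 1` UNITS**: `rad i + (S + 1) ≤ L^i·(ρ + S + 1)` for `L ≥ 2` — in fine units `□_{k−i}` has radius `< L^k(ρ + S + 1)`, uniformly
in `k` (the annuli (144) shrink geometrically outward: «□̃ is a cube with dist(□, □̃ᶜ) = 2R₁M₁L^kη» contains them all). [cite: Balaban1985Variational, (144) p.300] -/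
theorem rad_add_le {L : ℕ} (hL : 2 ≤ L) (ρ S : ℕ) : ∀ i : ℕ, rad L ρ S i + (S + 1) ≤ L ^ i * (ρ + S + 1)
  | 0 => by simp [add_assoc]
  | i + 1 => by
    have ih := rad_add_le hL ρ S i
    rw [rad_succ, pow_succ', mul_assoc]
    generalize hT : L ^ i * (ρ + S + 1) = T at ih ⊢
    generalize hR : rad L ρ S i = R at ih ⊢
    have h1 : L * R + (L * S + L) ≤ L * T := by
      have h := Nat.mul_le_mul_left L ih
      rwa [Nat.mul_add, Nat.mul_succ] at h
    have h2 : 2 * S ≤ L * S := Nat.mul_le_mul_right S hL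
    omega

/-- monotonicity in `i` for `L ≥ 1`. [cite: Balaban1985Variational, (144) p.300] -/
theorem rad_le_rad_succ {L : ℕ} (hL : 1 ≤ L) (ρ S i : ℕ) : rad L ρ S i ≤ rad L ρ S (i + 1) := by
  rw [rad_succ]
  nlinarith [Nat.le_mul_of_pos_left (rad L ρ S i) hL]

/-! ## §2 Cross-level distance inequalities on the Setup tori -/

/-- **ONE LEVEL OF BLOCKING COSTS AT MOST A FACTOR `L` AND `L − 1`, COORDINATEWISE**: for `j + 1 ≤ m + K` (so that `sitesPerDir j = L·sitesPerDir (j+1)`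
and `B(y)_μ = ⌊y_μ/L⌋`), the circular distance of the labels satisfies `|y_μ − c_μ|_∘ ≤ L·|B(y)_μ − B(c)_μ|_∘ + (L − 1)`. [folklore] -/
theorem natAbs_valMinAbs_sub_le_blockOf (hj : j + 1 ≤ P.m + P.K) (y c : Site P j) (μ : Fin P.d) :
    ((y μ - c μ).valMinAbs).natAbs ≤ P.L * (((blockOf y) μ - (blockOf c) μ).valMinAbs).natAbs + (P.L - 1) := by
  have hLpos : 0 < P.L := P.L_pos
  have hN : P.sitesPerDir j = P.sitesPerDir (j + 1) * P.L := P.sitesPerDir_eq_mul_succ hj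
  set a : ℕ := (y μ).val with ha
  set b : ℕ := (c μ).val with hb
  have hA : ((blockOf y) μ).val = a / P.L := Site.val_blockOf hj y μ
  have hB : ((blockOf c) μ).val = b / P.L := Site.val_blockOf hj c μ
  set δ : ℤ := (((blockOf y) μ - (blockOf c) μ).valMinAbs : ℤ) with hδ
  -- `δ ≡ ⌊a/L⌋ − ⌊b/L⌋ (mod N′)`
  have hδ' : ((δ : ℤ) : ZMod (P.sitesPerDir (j + 1))) = ((((a / P.L : ℕ) : ℤ) - ((b / P.L : ℕ) : ℤ) : ℤ) : ZMod (P.sitesPerDir (j + 1))) := by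
    rw [hδ, ZMod.coe_valMinAbs, Int.cast_sub, Int.cast_natCast, Int.cast_natCast, ← hA, ← hB, ZMod.natCast_zmod_val,
      ZMod.natCast_zmod_val]
  obtain ⟨t, ht⟩ := (ZMod.intCast_eq_intCast_iff_dvd_sub _ _ _).1 hδ'
  -- the integer representative `z = Lδ + (a mod L) − (b mod L)` of `y_μ − c_μ`
  set w : ℤ := (P.L : ℤ) * δ with hw
  set z : ℤ := w + ((a % P.L : ℕ) : ℤ) - ((b % P.L : ℕ) : ℤ) with hz
  have hda := Nat.div_add_mod a P.L
  have hdb := Nat.div_add_mod b P.L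
  have hzab : z = (a : ℤ) - (b : ℤ) - (P.sitesPerDir j : ℤ) * t := by
    have h1 : (a : ℤ) = (P.L : ℤ) * ((a / P.L : ℕ) : ℤ) + ((a % P.L : ℕ) : ℤ) := by exact_mod_cast hda.symm
    have h2 : (b : ℤ) = (P.L : ℤ) * ((b / P.L : ℕ) : ℤ) + ((b % P.L : ℕ) : ℤ) := by exact_mod_cast hdb.symm
    have h3 : (P.sitesPerDir j : ℤ) = (P.sitesPerDir (j + 1) : ℤ) * (P.L : ℤ) := by exact_mod_cast hN
    rw [hz, hw, h1, h2, h3]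
    linear_combination (-(P.L : ℤ)) * ht
  have he : (((y μ - c μ).valMinAbs : ℤ) : ZMod (P.sitesPerDir j)) = ((z : ℤ) : ZMod (P.sitesPerDir j)) := by
    rw [ZMod.coe_valMinAbs, hzab]
    push_cast
    rw [ZMod.natCast_self, zero_mul, sub_zero, ha, hb, ZMod.natCast_zmod_val, ZMod.natCast_zmod_val]
  have hmin := ZMod.natAbs_min_of_le_div_two (P.sitesPerDir j) _ z he (ZMod.natAbs_valMinAbs_le _)
  have hwabs : w.natAbs = P.L * δ.natAbs := by rw [hw, Int.natAbs_mul, Int.natAbs_natCast]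
  have hra : a % P.L < P.L := Nat.mod_lt a hLpos
  have hrb : b % P.L < P.L := Nat.mod_lt b hLpos
  have hzle : z.natAbs ≤ w.natAbs + (P.L - 1) := by
    rw [hz]
    omega
  calc ((y μ - c μ).valMinAbs).natAbs ≤ z.natAbs := hmin
    _ ≤ w.natAbs + (P.L - 1) := hzle
    _ = P.L * δ.natAbs + (P.L - 1) := by rw [hwabs]

/-- **THE CROSS-LEVEL DISTANCE INEQUALITY**: `dist_j(y, c) ≤ L·dist_{j+1}(B(y), B(c)) + (L − 1)` for the sup circular distances of the Setup tori
(`j + 1 ≤ m + K`). [folklore] -/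
theorem distSite_le_blockOf (hj : j + 1 ≤ P.m + P.K) (y c : Site P j) :
    distSite (Mk P j) y c ≤ (P.L : ℝ) * distSite (Mk P (j + 1)) (blockOf y) (blockOf c) + ((P.L : ℝ) - 1) := by
  unfold distSite
  have hL1 : (1 : ℝ) ≤ P.L := by exact_mod_cast P.L_pos
  have key : (Finset.univ.sup fun μ : Fin P.d => ((y μ - c μ).valMinAbs).natAbs) ≤
      P.L * (Finset.univ.sup fun μ : Fin P.d => (((blockOf y) μ - (blockOf c) μ).valMinAbs).natAbs) + (P.L - 1) := by
    refine Finset.sup_le fun μ _ => (natAbs_valMinAbs_sub_le_blockOf hj y c μ).trans ?_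
    exact Nat.add_le_add_right (Nat.mul_le_mul_left _
      (Finset.le_sup (f := fun μ : Fin P.d => (((blockOf y) μ - (blockOf c) μ).valMinAbs).natAbs) (Finset.mem_univ μ))) _
  have hcast := (Nat.cast_le (α := ℝ)).2 key
  have hsub : ((P.L - 1 : ℕ) : ℝ) = (P.L : ℝ) - 1 := by rw [Nat.cast_sub P.L_pos, Nat.cast_one]
  simpa [Nat.cast_add, Nat.cast_mul, hsub] using hcast

/-- the centre's block tower: `c_{j+1} = B(c_j)`. [cite: Balaban1984PropagatorsI, (1.18) p.20] -/
theorem iterBlockOf_succ' (i : ℕ) (x : Site P 0) : iterBlockOf (i + 1) x = blockOf (iterBlockOf i x) := rfl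

/-! ## §3 The cubes -/

/-- **`□_j^{(j)}`** — the `j`-blocks within sup circular distance `rad (k − j)` of the centre's `j`-block `c_j = iterBlockOf j x₀` (for `j ≤ k`; the
value for `j > k` is not used). [cite: Balaban1985Variational, (144) p.300] -/
def cubeFin (x₀ : Site P 0) (k ρ S : ℕ) (j : ℕ) : Finset (Site P j) :=
  Finset.univ.filter fun y => distSite (Mk P j) y (iterBlockOf j x₀) ≤ (rad P.L ρ S (k - j) : ℝ)

/-- membership. [cite: Balaban1985Variational, (144) p.300] -/
theorem mem_cubeFin_iff (x₀ : Site P 0) (k ρ S j : ℕ) (y : Site P j) :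
    y ∈ cubeFin x₀ k ρ S j ↔ distSite (Mk P j) y (iterBlockOf j x₀) ≤ (rad P.L ρ S (k - j) : ℝ) := by
  simp [cubeFin]

/-- the centre's block belongs to every cube. [cite: Balaban1985Variational, (144) p.300] -/
theorem iterBlockOf_center_mem_cubeFin (x₀ : Site P 0) (k ρ S j : ℕ) : iterBlockOf j x₀ ∈ cubeFin x₀ k ρ S j := by
  rw [mem_cubeFin_iff, distSite_self]
  exact Nat.cast_nonneg _

/-- **NESTING, ONE LEVEL**: if the `(j+1)`-block of `y` lies in `□_{j+1}^{(j+1)}` then `y ∈ □_j^{(j)}` (`j + 1 ≤ k`, `k ≤ m + K`) — from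
`distSite_le_blockOf` and `rad (k−j) = L·rad (k−j−1) + (L−1) + S`. [cite: Balaban1985Variational, (144) p.300; Balaban1984PropagatorsII, (2.1) p.224] -/
theorem blockOf_mem_cubeFin {x₀ : Site P 0} {k ρ S : ℕ} (hk : k ≤ P.m + P.K) {j : ℕ} (hjk : j + 1 ≤ k) {y : Site P j}
    (hy : blockOf y ∈ cubeFin x₀ k ρ S (j + 1)) : y ∈ cubeFin x₀ k ρ S j := by
  rw [mem_cubeFin_iff] at hy ⊢
  have hj : j + 1 ≤ P.m + P.K := hjk.trans hk
  have hkj : k - j = (k - (j + 1)) + 1 := by omega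
  have hL0 : (0 : ℝ) ≤ P.L := Nat.cast_nonneg _
  calc distSite (Mk P j) y (iterBlockOf j x₀)
      ≤ (P.L : ℝ) * distSite (Mk P (j + 1)) (blockOf y) (blockOf (iterBlockOf j x₀)) + ((P.L : ℝ) - 1) :=
        distSite_le_blockOf hj y (iterBlockOf j x₀)
    _ ≤ (P.L : ℝ) * (rad P.L ρ S (k - (j + 1)) : ℝ) + ((P.L : ℝ) - 1) := by
        have := mul_le_mul_of_nonneg_left hy hL0
        rw [← iterBlockOf_succ'] ; linarith
    _ ≤ (rad P.L ρ S (k - j) : ℝ) := by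
        rw [hkj, rad_succ]
        have hsub : ((P.L - 1 : ℕ) : ℝ) = (P.L : ℝ) - 1 := by rw [Nat.cast_sub P.L_pos, Nat.cast_one]
        push_cast
        rw [hsub]
        linarith [(Nat.cast_nonneg S : (0 : ℝ) ≤ S)]

/-- **THE CUBE SEQUENCE (144) AS A NESTED DOMAIN FAMILY OF [Balaban1984PropagatorsII] (2.1)–(2.4)** on the Setup torus: top level `k ≤ m + K`, centre
`x₀`, inner radius `ρ`, separation `S`; `Om 0 = T` (`Λ₀ = T ∖ □₁` frozen), `Om j = □_j^{(j)}` for `1 ≤ j ≤ k`, `Om j = ∅` beyond.  Print's `H` of (157) is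
`B6SectA.hOp (GE D …) (QsE D) (EE D …)` and `G̃ = GE − H∘QE∘GE` for `D :=` this family (lit-balaban `B6SectAVectorModelV1`/`B6SectACriticalPointV1`).
[cite: Balaban1985Variational, (144) p.300, (150) p.301, (157) p.302; Balaban1984PropagatorsII, (2.1)-(2.4) p.224] -/
def cubeSeq (x₀ : Site P 0) (k : ℕ) (hk : k ≤ P.m + P.K) (ρ S : ℕ) : Domains P where
  k := k
  hk := hk
  Om j := if j = 0 then Finset.univ else if j ≤ k then cubeFin x₀ k ρ S j else ∅
  Om_zero := by simp
  Om_eq_empty j hj := by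
    have h0 : j ≠ 0 := by omega
    simp [h0, not_le.mpr hj]
  nested j y hy := by
    by_cases hjk : j + 1 ≤ k
    · have hy' : blockOf y ∈ cubeFin x₀ k ρ S (j + 1) := by simpa [hjk] using hy
      by_cases hj0 : j = 0
      · simp [hj0]
      · have hjle : j ≤ k := by omega
        simpa [hj0, hjle] using blockOf_mem_cubeFin hk hjk hy'
    · exfalso
      simp [hjk] at hy

/-- the top level of `cubeSeq` is `k`. [cite: Balaban1985Variational, (144) p.300] -/
@[simp] theorem cubeSeq_k (x₀ : Site P 0) (k : ℕ) (hk : k ≤ P.m + P.K) (ρ S : ℕ) : (cubeSeq x₀ k hk ρ S).k = k := rfl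

/-- the positive levels of `cubeSeq` are the cubes. [cite: Balaban1985Variational, (144) p.300] -/
theorem cubeSeq_Om_pos (x₀ : Site P 0) {k : ℕ} (hk : k ≤ P.m + P.K) (ρ S : ℕ) {j : ℕ} (hj : 1 ≤ j) (hjk : j ≤ k) :
    (cubeSeq x₀ k hk ρ S).Om j = cubeFin x₀ k ρ S j := by
  have h0 : j ≠ 0 := by omega
  simp [cubeSeq, h0, hjk]

/-- level `0` of `cubeSeq` is the whole torus (`Λ₀ = T ∖ □₁` frozen). [cite: Balaban1984PropagatorsII, (2.3)-(2.4) p.224] -/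
theorem cubeSeq_Om_zero (x₀ : Site P 0) {k : ℕ} (hk : k ≤ P.m + P.K) (ρ S : ℕ) : (cubeSeq x₀ k hk ρ S).Om 0 = Finset.univ := rfl

/-- **`□_j` AS A SET OF FINE SITES** (`□_j = Bʲ(□_j^{(j)})`, INCLUDING `□₀` = the fine cube of radius `rad k`; `∅` beyond `k`): the domain-sequence
letter `Ω : ℕ → Set (Site P 0)` of `B8Thm2SetupTorus.pullDom` / `Prop7LocalChart`. [cite: Balaban1985Variational, (144) p.300; Balaban1985RegularSpaces, (1.3)-(1.4) p.77] -/
def cubeSet (x₀ : Site P 0) (k ρ S : ℕ) : ℕ → Set (Site P 0) :=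
  fun j => if j ≤ k then {x | iterBlockOf j x ∈ cubeFin x₀ k ρ S j} else ∅

/-- membership for `j ≤ k`. [cite: Balaban1985Variational, (144) p.300] -/
theorem mem_cubeSet_iff {x₀ : Site P 0} {k ρ S j : ℕ} (hjk : j ≤ k) (x : Site P 0) :
    x ∈ cubeSet x₀ k ρ S j ↔ distSite (Mk P j) (iterBlockOf j x) (iterBlockOf j x₀) ≤ (rad P.L ρ S (k - j) : ℝ) := by
  simp [cubeSet, hjk, mem_cubeFin_iff]

/-- `□₀` is the fine cube of radius `rad k` about `x₀`. [cite: Balaban1985Variational, (144) p.300] -/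
theorem mem_cubeSet_zero_iff (x₀ : Site P 0) (k ρ S : ℕ) (x : Site P 0) :
    x ∈ cubeSet x₀ k ρ S 0 ↔ distSite (Mk P 0) x x₀ ≤ (rad P.L ρ S k : ℝ) := by
  rw [mem_cubeSet_iff (Nat.zero_le k)]
  simp

/-- beyond the top level the family is empty. [cite: Balaban1985RegularSpaces, (1.3) p.77] -/
theorem cubeSet_of_lt {x₀ : Site P 0} {k ρ S j : ℕ} (hkj : k < j) : cubeSet x₀ k ρ S j = ∅ := by
  simp [cubeSet, not_le.mpr hkj]

/-- **THE TWO READINGS AGREE**: for `1 ≤ j ≤ k`, `x ∈ □_j` (fine set) iff its `j`-block lies in `Om j` of `cubeSeq` (`Domains.InOm`).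
[cite: Balaban1984PropagatorsII, (2.1) p.224] -/
theorem inOm_cubeSeq_iff {x₀ : Site P 0} {k : ℕ} (hk : k ≤ P.m + P.K) {ρ S j : ℕ} (hj : 1 ≤ j) (hjk : j ≤ k) (x : Site P 0) :
    (cubeSeq x₀ k hk ρ S).InOm j x ↔ x ∈ cubeSet x₀ k ρ S j := by
  unfold Domains.InOm
  rw [cubeSeq_Om_pos x₀ hk ρ S hj hjk]
  simp [cubeSet, hjk]

/-- at level `0` every fine site is in `Om 0` of `cubeSeq` (the structure's convention), while `cubeSet … 0 = □₀`. [cite: Balaban1984PropagatorsII, (2.3) p.224] -/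
theorem inOm_cubeSeq_zero {x₀ : Site P 0} {k : ℕ} (hk : k ≤ P.m + P.K) (ρ S : ℕ) (x : Site P 0) : (cubeSeq x₀ k hk ρ S).InOm 0 x := by
  unfold Domains.InOm
  rw [cubeSeq_Om_zero]
  exact Finset.mem_univ _

/-- **NESTING OF THE FINE SETS**: `□_{j+1} ⊆ □_j` (`j + 1 ≤ k ≤ m + K`). [cite: Balaban1985Variational, (144) p.300] -/
theorem cubeSet_succ_subset {x₀ : Site P 0} {k : ℕ} (hk : k ≤ P.m + P.K) (ρ S : ℕ) {j : ℕ} (hjk : j + 1 ≤ k) :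
    cubeSet x₀ k ρ S (j + 1) ⊆ cubeSet x₀ k ρ S j := by
  intro x hx
  have hx' : iterBlockOf (j + 1) x ∈ cubeFin x₀ k ρ S (j + 1) := by simpa [cubeSet, hjk] using hx
  have hjle : j ≤ k := by omega
  simpa [cubeSet, hjle] using blockOf_mem_cubeFin hk hjk hx'

/-- nesting across several levels: `□_{j'} ⊆ □_j` for `j ≤ j' ≤ k`. [cite: Balaban1985Variational, (144) p.300] -/
theorem cubeSet_antitone {x₀ : Site P 0} {k : ℕ} (hk : k ≤ P.m + P.K) (ρ S : ℕ) {j j' : ℕ} (hjj : j ≤ j') (hj'k : j' ≤ k) :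
    cubeSet x₀ k ρ S j' ⊆ cubeSet x₀ k ρ S j := by
  induction hjj with
  | refl => exact le_rfl
  | step hle ih =>
    rename_i j''
    exact (cubeSet_succ_subset hk ρ S hj'k).trans (ih (by omega))

/-- the centre lies in every cube `□_j`, `j ≤ k`. [cite: Balaban1985Variational, (144) p.300] -/
theorem center_mem_cubeSet (x₀ : Site P 0) {k ρ S j : ℕ} (hjk : j ≤ k) : x₀ ∈ cubeSet x₀ k ρ S j := by
  rw [mem_cubeSet_iff hjk, distSite_self]
  exact Nat.cast_nonneg _

/-- **(144), THE SEPARATION OF CONSECUTIVE CUBES**: a fine site of `□_{n+1}` and a fine site OUTSIDE `□_n` (`n + 1 ≤ k ≤ m + K`) have `n`-blocks at sup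
circular distance `≥ S + 1` in level-`n` units — print's «dist(□_{n+1}, □_nᶜ) = R₁M₁Lⁿη» with `S = R₁M₁`.
[cite: Balaban1985Variational, (144) p.300; Balaban1984PropagatorsII, (2.2) p.224] -/
theorem sep144 {x₀ : Site P 0} {k : ℕ} (hk : k ≤ P.m + P.K) {ρ S n : ℕ} (hnk : n + 1 ≤ k) {x x' : Site P 0}
    (hx : x ∈ cubeSet x₀ k ρ S (n + 1)) (hx' : x' ∉ cubeSet x₀ k ρ S n) :
    (S : ℝ) + 1 ≤ distSite (Mk P n) (iterBlockOf n x) (iterBlockOf n x') := by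
  have hn : n + 1 ≤ P.m + P.K := hnk.trans hk
  have hnle : n ≤ k := by omega
  rw [mem_cubeSet_iff hnk] at hx
  rw [mem_cubeSet_iff hnle, not_le] at hx'
  have hkn : k - n = (k - (n + 1)) + 1 := by omega
  have hL0 : (0 : ℝ) ≤ P.L := Nat.cast_nonneg _
  -- the `n`-block of `x` is within `L·rad(k−n−1) + (L−1)` of `c_n`
  have h1 : distSite (Mk P n) (iterBlockOf n x) (iterBlockOf n x₀) ≤ (P.L : ℝ) * (rad P.L ρ S (k - (n + 1)) : ℝ) + ((P.L : ℝ) - 1) := by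
    have := distSite_le_blockOf hn (iterBlockOf n x) (iterBlockOf n x₀)
    rw [← iterBlockOf_succ', ← iterBlockOf_succ'] at this
    have h2 := mul_le_mul_of_nonneg_left hx hL0
    linarith
  -- `c_n` to the `n`-block of `x′` is `> rad(k−n) = L·rad(k−n−1) + (L−1) + S`
  have h3 : (rad P.L ρ S (k - n) : ℝ) = (P.L : ℝ) * (rad P.L ρ S (k - (n + 1)) : ℝ) + ((P.L : ℝ) - 1) + (S : ℝ) := by
    rw [hkn, rad_succ]
    have hsub : ((P.L - 1 : ℕ) : ℝ) = (P.L : ℝ) - 1 := by rw [Nat.cast_sub P.L_pos, Nat.cast_one]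
    push_cast
    rw [hsub]
  have htri := distSite_triangle (Mk P n) (iterBlockOf n x₀) (iterBlockOf n x) (iterBlockOf n x')
  rw [distSite_comm (Mk P n) (iterBlockOf n x₀) (iterBlockOf n x)] at htri
  rw [distSite_comm (Mk P n) (iterBlockOf n x') (iterBlockOf n x₀)] at hx'
  -- integrality: distances are natural numbers, so `> rad` means `≥ rad + 1`
  have hint : ((rad P.L ρ S (k - n) : ℕ) : ℝ) + 1 ≤ distSite (Mk P n) (iterBlockOf n x₀) (iterBlockOf n x') := by
    unfold distSite at hx' ⊢
    have := (Nat.cast_lt (α := ℝ)).1 hx'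
    exact_mod_cast this
  linarith

/-! ## §4 At the d = 3 carrier -/

section T3

open T3ContinuumYM3Torus (T3Family)

/-- **THE CUBE SEQUENCE (144) AT THE d = 3 CARRIER** (`P = F.P K`, top level `k = K − n`, `L^kη = 1`): centre `x₀`, inner radius `ρ`, separation `S`
(print: `ρ ≥ M + …`, `S = R₁M₁`). [cite: Balaban1985Variational, (144) p.300] -/
def cubeSeqT3 (F : T3Family) (n K : ℕ) (x₀ : Site (F.P K) 0) (ρ S : ℕ) : Domains (F.P K) :=
  cubeSeq x₀ (K - n) (FlatMinimizerH.le_T3 F n K) ρ S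

/-- its top level is `K − n`. [cite: Balaban1985Variational, (144) p.300] -/
@[simp] theorem cubeSeqT3_k (F : T3Family) (n K : ℕ) (x₀ : Site (F.P K) 0) (ρ S : ℕ) : (cubeSeqT3 F n K x₀ ρ S).k = K - n := rfl

end T3

end Summit.QuantumFields.YangMills.Theorems.FlatCubeSequence

end
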